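import Summits.BirchSwinnertonDyer.BirchSwinnertonDyer.Theorems.InertBadSignedBranchesInertBadAtThreeIstarZeroOddMissingInput
import Summits.BirchSwinnertonDyer.BirchSwinnertonDyer.Theorems.InertBadSignedBranchesCccOneLawOnTypeIstarZeroOfEtaGZ
import HarnessLib

/-!
# Route `InertBadSignedBranches` (rung K8), D71 child `InertBadAtThreeIstarZero`: the child at `p = 3`
# (and the typed missing input on `(p, I₀*)` at any odd `p`) MODULO the η-branch `p`-adic Gross–Zagier
# valuation identity (GZ_η-VAL) in PRINT CURRENCY instead of the law in divisibility-level form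
# (helper toward stmt-BirchSwinnertonDyer-19656; cell bsd-cm, seat bsd-cm-inert g10; nothing asserted)

`…OddMissingInput.lean` (this seat) proves the child's statement — `HasSignedLocalType W 3 (I₀*) →
r_an(W) = 1 → Typed.X12.MissingInputAt W 3` — modulo C-cc-1@3 in PAIR FORM (the body of the typed law
`QuadraticBranchMinusLeadingValuationAt W p 0` without its `5 ≤ p` guard: the `p`-DIVISIBILITY LEVEL of
the generator in `W(ℚ_p)`), (C1_η)@3, the readings, the named facts and `hper`@3. The crux-side sibling
`…CccOneLawOnTypeIstarZeroOfEtaGZ.lean` proves `EtaGZ.valuation_padicLog_eq_level`: at an ADDITIVE prime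
with `p ∤ c_p` and `W(ℚ_p)[p] = 0` the divisibility level IS `ord_p log_ω(P)`. THIS FILE combines them at
any odd `p` and at `p = 3`:

* `missingInputAt_IstarZero_of_etaGZValuation_of_readings_of_ne_two` — ∀ `W` of signed type `(p, I₀*)`,
  `r_an = 1`: `Typed.X12.MissingInputAt W p` ⟸ (GZ_η-VAL) on the type at `p` (`coeff₁ L ≠ 0 ∧
  v_p(coeff₁ L_p⁻(V, η, X)) = 2·ord_p log_ω(P) + ord_p(L′(W,1)/(Ω_W·Reg W))` for every twin datum and
  generator) ∧ (C1_η) ∧ readings ((R2) typed + Kobayashi 7.4 exact) ∧ `hmod hGZ hGZK hPT hnf` ∧ `hper` ∧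
  `ord_p c_p = 0` on the type;
* `missingInputAt_IstarZero_three_of_etaGZValuation_of_readings` — THE CHILD `InertBadAtThreeIstarZero`
  MODULO (GZ_η-VAL)@3 ∧ (C1_η)@3 ∧ readings@3 ∧ named facts ∧ `hper`@3 (Tamagawa hypothesis discharged:
  `3 ∤ Tam(W)` on the CM locus; parity data read at `p* = −3`).

HONEST STATUS: (GZ_η-VAL) is the cell's OWN statement (valuation content of N7-LEDGER §5 / R98; PAPER
from (GZ_η) — at `p = 3` by memo N21 v1.2, referee PASS; in NO source), a HYPOTHESIS here; (C1_η) is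
conjecture-grade; readings are hypothesis texts; nothing is booked; the child stays open; the sibling
child `InertBadAtThreeOffIstarZero` (III/III* at 3) is untouched.
[cite: Kobayashi2003, §3 (3.5)–(3.7) (p. 7), §4 (p. 8), Thm. 7.4 (p. 13)] [cite: Miller2011LMS, §1 and Def. 1.1]
[cite: SilvermanAEC2009, IV.6.4, VII.6.1, VII.6.3] [cite: SilvermanATAEC1994, IV.9.4 and Table 4.1]
-/

set_option autoImplicit false
set_option linter.dupNamespace false

noncomputable section

open scoped Classical MatrixGroups ModularForm NumberField

open CongruenceSubgroup Field NumberField IsDedekindDomain IsDedekindDomain.HeightOneSpectrum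
  WeierstrassCurve Rat.HeightOneSpectrum
open Literature.NumberTheory.EllipticCurves
open Literature.NumberTheory.EllipticCurves.ModularForms
open Literature.NumberTheory.EllipticCurves.Kobayashi2003 hiding IsQuadraticBranchMinusLFunction
open Literature.NumberTheory.EllipticCurves.Rank1Residual
open Literature.NumberTheory.EllipticCurves.Rank1Residual.Typed
open Literature.NumberTheory.GaloisRepresentations
open Literature.NumberTheory.GaloisCohomology
open Summit.BirchSwinnertonDyer.Rank1Residual
open Summit.BirchSwinnertonDyer.Rank1Residual.Additive
open Summit.BirchSwinnertonDyer.Rank1Residual.Additive.LocalLog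
open Summit.BirchSwinnertonDyer.Rank1Residual.X12.O10
open Summit.BirchSwinnertonDyer.BirchSwinnertonDyer.Theorems.EtaGZ

namespace Summit.BirchSwinnertonDyer.BirchSwinnertonDyer.Theorems.InertBadOdd

variable (p : ℕ) [hp : Fact p.Prime]

/-- **The typed missing input on `(p, I₀*)` at any ODD `p` FROM (GZ_η-VAL) in print currency** (log of
the generator instead of its divisibility level): §4 of `…OddMissingInput.lean` with its pair-form law
hypothesis produced from `hGZ` by `EtaGZ.valuation_padicLog_eq_level` (the curve is additive at `p`
on the type; `ord_p c_p = 0` is the displayed hypothesis `hcp`, transported to `W ⊗ ℚ_p` by the tree's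
`localTamagawaNumber_padic_eq`; `W(ℚ_p)[p] = 0` is a binder of the pair form) and the two currencies of
the analytic side matched by `leadingTerm_eq_of_shaAn_eq`. CONDITIONAL; nothing booked.
[cite: Kobayashi2003, §4 (p. 8), Thm. 7.4 (p. 13)] [cite: Miller2011LMS, §1 and Def. 1.1]
[cite: SilvermanAEC2009, IV.6.4 and VII.6.3] -/
theorem missingInputAt_IstarZero_of_etaGZValuation_of_readings_of_ne_two
    (hmod : hasEntireLFunction_rat) (hGZfact : GrossZagier1986_thm_I_7_3)
    (hGZK : rank_eq_analyticRank_of_analyticRank_le_one)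
    (hPT : poitouTate_selmerStructure_duality_real ℚ) (hnf : exists_isNewformOf)
    (hper : ∀ (V : WeierstrassCurve ℚ) [V.IsElliptic] [V.IsGloballyMinimal]
      {N : ℕ} [NeZero N] (f : CuspForm (Gamma0 N) 2), IsNewformOf V f →
      V.HasGoodReductionAtPrime p → V.frobeniusTrace p = 0 →
      ∃ ϖ : ℚ, ‖(ϖ : ℚ_[p])‖ ≤ 1 ∧
        (if Even (p / 2) then (ϖ : ℝ) * V.realPeriodRat = plusPeriod f
          else (ϖ : ℝ) * V.imaginaryPeriodRat = minusPeriod f))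
    (hGZ : ∀ (W : WeierstrassCurve ℚ) [W.IsElliptic] [W.IsGloballyMinimal],
      HasSignedLocalType W p (.Istar 0) → W.analyticRank = 1 →
      ∀ (V : WeierstrassCurve ℚ) [V.IsElliptic] [V.IsGloballyMinimal] (C : VariableChange ℚ)
        {N : ℕ} [NeZero N] {f : CuspForm (Gamma0 N) 2},
        C • W.quadraticTwist ((-1) ^ (p / 2) * p) = V →
        V.HasGoodReductionAtPrime p → V.frobeniusTrace p = 0 → IsNewformOf V f →
        ∀ (ϖ : ℚ), (if Even (p / 2) then (ϖ : ℝ) * V.realPeriodRat = plusPeriod f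
            else (ϖ : ℝ) * V.imaginaryPeriodRat = minusPeriod f) →
        ∀ (L : IwasawaAlgebra p), IsQuadraticBranchMinusLFunction f p ϖ L →
        ∀ (P : W.toAffine.Point), ¬ IsOfFinAddOrder P →
        (∀ R : W.toAffine.Point, ∃ (k : ℤ) (T : W.toAffine.Point), IsOfFinAddOrder T ∧ R = k • P + T) →
        ∀ (q : ℚ), W.leadingLCoeff / ((W.realPeriodRat * W.regulator : ℝ) : ℂ) = (q : ℂ) →
        PowerSeries.coeff 1 L ≠ 0 ∧
          ((PowerSeries.coeff 1 L : ℤ_[p]) : ℚ_[p]).valuation =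
            2 * (padicLog (W.baseChange ℚ_[p]) (W.toPadicPoint p P)).valuation + padicValRat p q)
    (hRd : ∀ (W : WeierstrassCurve ℚ) [W.IsElliptic] [W.IsGloballyMinimal],
      HasSignedLocalType W p (.Istar 0) → W.analyticRank = 1 →
      OddBranchStrictMinusNoFiniteSubmoduleAt W p ∧
      ∀ (V : WeierstrassCurve ℚ) [V.IsElliptic] [V.IsGloballyMinimal] (C : VariableChange ℚ)
        {N : ℕ} [NeZero N] {f : CuspForm (Gamma0 N) 2},
        p ≠ 2 → C • W.quadraticTwist ((-1) ^ (p / 2) * p) = V →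
        V.HasGoodReductionAtPrime p → V.frobeniusTrace p = 0 →
        QuadraticBranchPlusMainConjectureAt V p → IsNewformOf V f →
        ∀ (ϖ : ℚ), (if Even (p / 2) then (ϖ : ℝ) * V.realPeriodRat = plusPeriod f
            else (ϖ : ℝ) * V.imaginaryPeriodRat = minusPeriod f) →
        ∀ (Lη : IwasawaAlgebra p), IsQuadraticBranchMinusLFunction f p ϖ Lη →
        ∀ (κ : ZpExtension ℚ p) (γ : Field.absoluteGaloisGroup ℚ),
          κ.IsCyclotomic → κ.IsTopGenerator γ → IsCyclotomicVariable p γ →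
        ∀ (D : StrictSignedSelmerDualData W κ ℚ_[p] γ (-1)) (L' : IwasawaAlgebra p),
          Lη = PowerSeries.X * L' → D.charIdeal = Ideal.span {L'})
    (hC1 : ∀ (V : WeierstrassCurve ℚ) [V.IsElliptic] [V.IsGloballyMinimal], V.HasCM →
      V.HasGoodReductionAtPrime p → CMInert V p → QuadraticBranchPlusMainConjectureAt V p)
    (hcp : ∀ (W : WeierstrassCurve ℚ) [W.IsElliptic] [W.IsGloballyMinimal],
      HasSignedLocalType W p (.Istar 0) →
      padicValNat p ((W.baseChange (((primesEquiv (R := 𝓞 ℚ)).symm ⟨p, hp.out⟩).adicCompletion ℚ)).localTamagawaNumber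
        (((primesEquiv (R := 𝓞 ℚ)).symm ⟨p, hp.out⟩).adicCompletionIntegers ℚ)) = 0)
    (hp2 : p ≠ 2) :
    ∀ (W : WeierstrassCurve ℚ) [W.IsElliptic] [W.IsGloballyMinimal],
      HasSignedLocalType W p (.Istar 0) → W.analyticRank = 1 → X12.MissingInputAt W p := by
  refine missingInputAt_IstarZero_of_pairLaw_of_readings_of_ne_two (p := p) hmod hGZfact hGZK hPT hnf
    hper ?_ hRd hC1 hcp hp2
  intro W _ _ hT hr V _ _ C N _ f hCV hgood hap hf ϖ hϖ L hL htors P n hP hgen hdiv hndiv q hq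
  -- the analytic side in the leading-term currency
  have hq' := leadingTerm_eq_of_shaAn_eq W hq
  obtain ⟨hne, hv⟩ := hGZ W hT hr V C hCV hgood hap hf ϖ hϖ L hL P hP hgen _ hq'
  -- `ord_p c_p(W ⊗ ℚ_p) = 0` in the `ℚ_p`-model currency, from the displayed `hcp`
  have hcp' : ¬ p ∣ (W.baseChange ℚ_[p]).localTamagawaNumber ℤ_[p] := by
    rw [localTamagawaNumber_padic_eq_holds W ((primesEquiv (R := 𝓞 ℚ)).symm ⟨p, hp.out⟩) p
      (by rw [Equiv.apply_symm_apply])]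
    intro h
    have h0 := hcp W hT
    rw [padicValNat.eq_zero_iff] at h0
    rcases h0 with h1 | h0 | hnd
    · exact hp.out.one_lt.ne' h1
    · exact localTamagawaNumber_adicCompletion_ne_zero W _ h0
    · exact hnd h
  -- the divisibility level is `ord_p log_ω(P)`
  obtain ⟨-, hlev⟩ := valuation_padicLog_eq_level W p
    (addv_of_hasSignedLocalType_of_twist_good W hT hp2 C hCV hgood) hcp' htors hdiv hndiv
  rw [hlev] at hv
  exact ⟨hne, hv⟩

/-- **THE D71 CHILD `InertBadAtThreeIstarZero` MODULO (GZ_η-VAL)@3 ∧ (C1_η)@3 ∧ readings ∧ named facts ∧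
`hper`@3** — for every globally minimal `W` of signed local type `(3, I₀*)` with `r_an(W) = 1`,
`Typed.X12.MissingInputAt W 3`; the Tamagawa hypothesis is DISCHARGED (`3 ∤ Tam(W)` for CM `W` with `3`
unramified, `padicValNat_localTamagawaNumber_eq_zero_of_hasCM_three`) and the parity data are read at
`p* = −3` (`η(−1) = −1`: the minus period). The print-currency twin of
`missingInputAt_IstarZero_three_of_pairLaw_of_readings`. CONDITIONAL; nothing booked.
[cite: Kobayashi2003, §4 (p. 8), Thm. 7.4 (p. 13)] [cite: SilvermanATAEC1994, IV.9.4 and Table 4.1]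
[cite: Miller2011LMS, §1 and Def. 1.1] -/
theorem missingInputAt_IstarZero_three_of_etaGZValuation_of_readings [h3 : Fact (Nat.Prime 3)]
    (hmod : hasEntireLFunction_rat) (hGZfact : GrossZagier1986_thm_I_7_3)
    (hGZK : rank_eq_analyticRank_of_analyticRank_le_one)
    (hPT : poitouTate_selmerStructure_duality_real ℚ) (hnf : exists_isNewformOf)
    (hper : ∀ (V : WeierstrassCurve ℚ) [V.IsElliptic] [V.IsGloballyMinimal]
      {N : ℕ} [NeZero N] (f : CuspForm (Gamma0 N) 2), IsNewformOf V f →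
      V.HasGoodReductionAtPrime 3 → V.frobeniusTrace 3 = 0 →
      ∃ ϖ : ℚ, ‖(ϖ : ℚ_[3])‖ ≤ 1 ∧ (ϖ : ℝ) * V.imaginaryPeriodRat = minusPeriod f)
    (hGZ : ∀ (W : WeierstrassCurve ℚ) [W.IsElliptic] [W.IsGloballyMinimal],
      HasSignedLocalType W 3 (.Istar 0) → W.analyticRank = 1 →
      ∀ (V : WeierstrassCurve ℚ) [V.IsElliptic] [V.IsGloballyMinimal] (C : VariableChange ℚ)
        {N : ℕ} [NeZero N] {f : CuspForm (Gamma0 N) 2},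
        C • W.quadraticTwist (-3) = V →
        V.HasGoodReductionAtPrime 3 → V.frobeniusTrace 3 = 0 → IsNewformOf V f →
        ∀ (ϖ : ℚ), (ϖ : ℝ) * V.imaginaryPeriodRat = minusPeriod f →
        ∀ (L : IwasawaAlgebra 3), IsQuadraticBranchMinusLFunction f 3 ϖ L →
        ∀ (P : W.toAffine.Point), ¬ IsOfFinAddOrder P →
        (∀ R : W.toAffine.Point, ∃ (k : ℤ) (T : W.toAffine.Point), IsOfFinAddOrder T ∧ R = k • P + T) →
        ∀ (q : ℚ), W.leadingLCoeff / ((W.realPeriodRat * W.regulator : ℝ) : ℂ) = (q : ℂ) →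
        PowerSeries.coeff 1 L ≠ 0 ∧
          ((PowerSeries.coeff 1 L : ℤ_[3]) : ℚ_[3]).valuation =
            2 * (padicLog (W.baseChange ℚ_[3]) (W.toPadicPoint 3 P)).valuation + padicValRat 3 q)
    (hRd : ∀ (W : WeierstrassCurve ℚ) [W.IsElliptic] [W.IsGloballyMinimal],
      HasSignedLocalType W 3 (.Istar 0) → W.analyticRank = 1 →
      OddBranchStrictMinusNoFiniteSubmoduleAt W 3 ∧
      ∀ (V : WeierstrassCurve ℚ) [V.IsElliptic] [V.IsGloballyMinimal] (C : VariableChange ℚ)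
        {N : ℕ} [NeZero N] {f : CuspForm (Gamma0 N) 2},
        (3 : ℕ) ≠ 2 → C • W.quadraticTwist (-3) = V →
        V.HasGoodReductionAtPrime 3 → V.frobeniusTrace 3 = 0 →
        QuadraticBranchPlusMainConjectureAt V 3 → IsNewformOf V f →
        ∀ (ϖ : ℚ), (ϖ : ℝ) * V.imaginaryPeriodRat = minusPeriod f →
        ∀ (Lη : IwasawaAlgebra 3), IsQuadraticBranchMinusLFunction f 3 ϖ Lη →
        ∀ (κ : ZpExtension ℚ 3) (γ : Field.absoluteGaloisGroup ℚ),
          κ.IsCyclotomic → κ.IsTopGenerator γ → IsCyclotomicVariable 3 γ →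
        ∀ (D : StrictSignedSelmerDualData W κ ℚ_[3] γ (-1)) (L' : IwasawaAlgebra 3),
          Lη = PowerSeries.X * L' → D.charIdeal = Ideal.span {L'})
    (hC1 : ∀ (V : WeierstrassCurve ℚ) [V.IsElliptic] [V.IsGloballyMinimal], V.HasCM →
      V.HasGoodReductionAtPrime 3 → CMInert V 3 → QuadraticBranchPlusMainConjectureAt V 3) :
    ∀ (W : WeierstrassCurve ℚ) [W.IsElliptic] [W.IsGloballyMinimal],
      HasSignedLocalType W 3 (.Istar 0) → W.analyticRank = 1 → X12.MissingInputAt W 3 := by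
  have h32 : ((-1 : ℚ) ^ (3 / 2) * (3 : ℕ)) = -3 := by norm_num
  have hodd : ¬ Even (3 / 2) := by decide
  refine missingInputAt_IstarZero_of_etaGZValuation_of_readings_of_ne_two 3 hmod hGZfact hGZK hPT hnf
    ?_ ?_ ?_ hC1 (fun W _ _ hT ↦ ?_) (by decide)
  · intro V _ _ N _ f hf hgood hap
    obtain ⟨ϖ, hϖ, hrel⟩ := hper V f hf hgood hap
    exact ⟨ϖ, hϖ, by rw [if_neg hodd]; exact hrel⟩
  · intro W _ _ hT hr V _ _ C N _ f hC hgood hap hf ϖ hϖ L hL P hP hgen q hq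
    rw [h32] at hC
    rw [if_neg hodd] at hϖ
    exact hGZ W hT hr V C hC hgood hap hf ϖ hϖ L hL P hP hgen q hq
  · intro W _ _ hT hr
    obtain ⟨hR2, h74x⟩ := hRd W hT hr
    refine ⟨hR2, ?_⟩
    intro V _ _ C N _ f h2 hC hgood hap h1 hf ϖ hϖ Lη hLη κ γ hκ hγ hγc D L' hLL'
    rw [h32] at hC
    rw [if_neg hodd] at hϖ
    exact h74x V C h2 hC hgood hap h1 hf ϖ hϖ Lη hLη κ γ hκ hγ hγc D L' hLL'
  · exact padicValNat_localTamagawaNumber_eq_zero_of_hasCM_three W hT.1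
      (not_cmRamified_of_hasSignedLocalType W 3 hT)

end Summit.BirchSwinnertonDyer.BirchSwinnertonDyer.Theorems.InertBadOdd

end
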